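import Summits.QuantumFields.YangMills.Theorems.IsotropyFromPowerCountingTemperedCurvatureMomentsThreePointChartBoundsPairPSD

/-!
# Three-point chart bounds X: the disjoint-pair bound in the standard frame

Support file for stub `stub_threePointChartBounds` (B) of reshape 4 of
`Cruxes/TemperedCurvatureMoments/Lines/Sketch.lean` (crux stmt-QuantumFields-17721, line `Sketch`).
The core bound `|𝔖₃(f₁⊗f₂⊗∂_wᴺg)|² ≤ 𝔖₄(pair)·𝔖₂(θq̄⊗q)` from the pair Gram property (Cauchy–Schwarz for the
`2 × 2` form), and the version uniform in the mirror level (translation, absorption into Schwartz weights).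
References: Osterwalder–Schrader, Comm. Math. Phys. 31 (1973) §4.1, 42 (1975) §4; Glimm–Jaffe, Quantum
Physics (1987) Thm. 6.1.3, §19.5. [folklore]
-/

noncomputable section

open scoped InnerProductSpace ComplexConjugate
open MeasureTheory Filter Set Complex
open _root_.Topology
open Literature.MathematicalPhysics.AQFT Literature.MathematicalPhysics.QuantumLattice
open Literature.MathematicalPhysics.QuantumFieldTheory
open scoped SchwartzMap LineDeriv
open Literature.MathematicalPhysics.QuantumLattice.SchwingerFamily (timeVec)
open Summit.QuantumFields.YangMills.Theorems.CurvatureKernel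
open Summit.QuantumFields.YangMills.Cruxes.PlanarSpectralCone.TwoMirrorLightconeSlots.DiscSections (translateMulti_time_space)

namespace Summit.QuantumFields.YangMills.Theorems.TemperedCurvatureMoments.Sketch.ThreePointChartBounds

section PartTwoCore

variable (S : SchwingerFamily (EuclideanSpace ℝ (Fin 4))) (h : OSReconstructionNoE1 S.toLabelled)

/-- **The three-point core bound for a disjoint pair (standard frame).**  With the pair Gram property in
place of the time ordering: `|𝔖₃(f₁ ⊗ f₂ ⊗ ∂_wᴺ g)|² ≤ 𝔖₄(pair) · 𝔖₂(θq̄ ⊗ q)` (Cauchy–Schwarz for the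
`2 × 2` Gram form), then the four-point temperedness bound and the reflected two-point estimate. [folklore] -/
theorem norm_three_point_core_disjoint
    (hcone : ∀ (ψ : h.Hilbert) (μ : Measure (EuclideanSpace ℝ (Fin 4))),
      h.IsJointSpectralMeasure ψ μ → μ {p | p 0 < |p 1|} = 0)
    (hpsd : (∀ (f₁ f₂ q : 𝓢(EuclideanSpace ℝ (Fin 4), ℂ)), HasCompactSupport (f₁ : EuclideanSpace ℝ (Fin 4) → ℂ) →
    HasCompactSupport (f₂ : EuclideanSpace ℝ (Fin 4) → ℂ) → HasCompactSupport (q : EuclideanSpace ℝ (Fin 4) → ℂ) →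
    tsupport (f₁ : EuclideanSpace ℝ (Fin 4) → ℂ) ⊆ {y | y 0 < 0} →
    tsupport (f₂ : EuclideanSpace ℝ (Fin 4) → ℂ) ⊆ {y | y 0 < 0} →
    tsupport (q : EuclideanSpace ℝ (Fin 4) → ℂ) ⊆ {y | 0 < y 0} →
    Disjoint (tsupport (f₁ : EuclideanSpace ℝ (Fin 4) → ℂ)) (tsupport (f₂ : EuclideanSpace ℝ (Fin 4) → ℂ)) →
    ∀ lam mu : ℂ,
    0 ≤ (conj lam * lam * S 4 (SchwartzMap.tensorFin 4 ![f₁, f₂, starTest (thetaTest 4 f₂), starTest (thetaTest 4 f₁)]) +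
        conj lam * mu * S 3 (SchwartzMap.tensorFin 3 ![f₁, f₂, q]) +
        conj mu * lam * S 3 (SchwartzMap.tensorFin 3 ![starTest (thetaTest 4 q), starTest (thetaTest 4 f₂),
          starTest (thetaTest 4 f₁)]) +
        conj mu * mu * S 2 (SchwartzMap.tensorFin 2 ![starTest (thetaTest 4 q), q])).re ∧
      (conj lam * lam * S 4 (SchwartzMap.tensorFin 4 ![f₁, f₂, starTest (thetaTest 4 f₂), starTest (thetaTest 4 f₁)]) +
        conj lam * mu * S 3 (SchwartzMap.tensorFin 3 ![f₁, f₂, q]) +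
        conj mu * lam * S 3 (SchwartzMap.tensorFin 3 ![starTest (thetaTest 4 q), starTest (thetaTest 4 f₂),
          starTest (thetaTest 4 f₁)]) +
        conj mu * mu * S 2 (SchwartzMap.tensorFin 2 ![starTest (thetaTest 4 q), q])).im = 0))
    (M₂ : ℕ) (C₂ : ℝ) (hS2 : ∀ F, ‖S 2 F‖ ≤ C₂ * schwartzNorm M₂ F)
    (M₄ : ℕ) (C₄ : ℝ) (hS4 : ∀ F, ‖S 4 F‖ ≤ C₄ * schwartzNorm M₄ F)
    (N : ℕ) {δ : ℝ} (hδ : 0 < δ) (hδ1 : δ ≤ 1) (f₁ f₂ g : 𝓢(EuclideanSpace ℝ (Fin 4), ℂ))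
    (hf₁c : HasCompactSupport (f₁ : EuclideanSpace ℝ (Fin 4) → ℂ))
    (hf₂c : HasCompactSupport (f₂ : EuclideanSpace ℝ (Fin 4) → ℂ))
    (hgc : HasCompactSupport (g : EuclideanSpace ℝ (Fin 4) → ℂ))
    (hf₁ : tsupport (f₁ : EuclideanSpace ℝ (Fin 4) → ℂ) ⊆ {y | y 0 < 0})
    (hf₂ : tsupport (f₂ : EuclideanSpace ℝ (Fin 4) → ℂ) ⊆ {y | y 0 < 0})
    (hg : tsupport (g : EuclideanSpace ℝ (Fin 4) → ℂ) ⊆ {y | δ < y 0})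
    (hdis : Disjoint (tsupport (f₁ : EuclideanSpace ℝ (Fin 4) → ℂ)) (tsupport (f₂ : EuclideanSpace ℝ (Fin 4) → ℂ)))
    {w : EuclideanSpace ℝ (Fin 4)} (hw : w = EuclideanSpace.single (0 : Fin 4) (1 : ℝ) ∨
      w = EuclideanSpace.single (1 : Fin 4) (1 : ℝ)) :
    ‖S 3 (SchwartzMap.tensorFin 3 ![f₁, f₂,
        ((∂_{w} : 𝓢(EuclideanSpace ℝ (Fin 4), ℂ) → 𝓢(EuclideanSpace ℝ (Fin 4), ℂ))^[N]) g])‖ ≤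
      ((2 * N : ℕ) / (Real.exp 1 * (δ / 2))) ^ N *
        (Real.sqrt (|C₄| * (2 ^ (M₄ + 1)) ^ 4) * Real.sqrt (2 * (|C₂| * (2 ^ (M₂ + 1)) ^ 2 * 16 ^ M₂))) *
        schwartzNorm M₄ f₁ * schwartzNorm M₄ f₂ * schwartzNorm M₂ g := by
  set q : 𝓢(EuclideanSpace ℝ (Fin 4), ℂ) :=
    ((∂_{w} : 𝓢(EuclideanSpace ℝ (Fin 4), ℂ) → 𝓢(EuclideanSpace ℝ (Fin 4), ℂ))^[N]) g with hqdef
  have hq0 : tsupport (q : EuclideanSpace ℝ (Fin 4) → ℂ) ⊆ {y | 0 < y 0} := fun y hy =>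
    lt_trans hδ (hg (tsupport_iterate_lineDerivOp_subset w N g hy))
  have hqc : HasCompactSupport (q : EuclideanSpace ℝ (Fin 4) → ℂ) :=
    hgc.mono' ((subset_tsupport _).trans (tsupport_iterate_lineDerivOp_subset w N g))
  obtain ⟨hz, ha0, hd0⟩ := normSq_le_of_psd2 (hpsd f₁ f₂ q hf₁c hf₂c hqc hf₁ hf₂ hq0 hdis)
  have hA := norm_four_point_pair_le S M₄ C₄ hS4 f₁ f₂
  have hD := norm_two_point_star_iterate_le S h hcone M₂ C₂ hS2 N hδ hδ1 g hg hw
  set A2 : ℝ := |C₄| * (2 ^ (M₄ + 1)) ^ 4 with hA2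
  set B2 : ℝ := 2 * (|C₂| * (2 ^ (M₂ + 1)) ^ 2 * 16 ^ M₂) with hB2
  set r : ℝ := (2 * N : ℕ) / (Real.exp 1 * (δ / 2)) with hr
  have hA2n : 0 ≤ A2 := by positivity
  have hB2n : 0 ≤ B2 := by positivity
  have hr0 : 0 ≤ r := by positivity
  have hRHS : 0 ≤ r ^ N * (Real.sqrt A2 * Real.sqrt B2) * schwartzNorm M₄ f₁ * schwartzNorm M₄ f₂ *
      schwartzNorm M₂ g := by
    have := schwartzNorm_nonneg M₄ f₁
    have := schwartzNorm_nonneg M₄ f₂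
    have := schwartzNorm_nonneg M₂ g
    positivity
  refine (pow_le_pow_iff_left₀ (norm_nonneg _) hRHS two_ne_zero).1 ?_
  have hsq : (r ^ N * (Real.sqrt A2 * Real.sqrt B2) * schwartzNorm M₄ f₁ * schwartzNorm M₄ f₂ *
      schwartzNorm M₂ g) ^ 2 = (A2 * (schwartzNorm M₄ f₁ ^ 2 * schwartzNorm M₄ f₂ ^ 2)) *
        (r ^ (2 * N) * (B2 * schwartzNorm M₂ g ^ 2)) := by
    rw [pow_mul' r 2 N]
    have hA' := Real.sq_sqrt hA2n
    have hB' := Real.sq_sqrt hB2n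
    calc (r ^ N * (Real.sqrt A2 * Real.sqrt B2) * schwartzNorm M₄ f₁ * schwartzNorm M₄ f₂ * schwartzNorm M₂ g) ^ 2
        = (Real.sqrt A2 ^ 2 * (schwartzNorm M₄ f₁ ^ 2 * schwartzNorm M₄ f₂ ^ 2)) *
          ((r ^ N) ^ 2 * (Real.sqrt B2 ^ 2 * schwartzNorm M₂ g ^ 2)) := by ring
      _ = _ := by rw [hA', hB']
  rw [hsq]
  have ha' := (Complex.re_le_norm _).trans hA
  have hd' := (Complex.re_le_norm _).trans hD
  calc ‖S 3 (SchwartzMap.tensorFin 3 ![f₁, f₂, q])‖ ^ 2 ≤ _ := hz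
    _ ≤ (A2 * (schwartzNorm M₄ f₁ ^ 2 * schwartzNorm M₄ f₂ ^ 2)) * (r ^ (2 * N) * (B2 * schwartzNorm M₂ g ^ 2)) :=
        mul_le_mul ha' hd' hd0 (by positivity)

/-- **The three-point bound for a disjoint pair in the standard frame**, uniformly in the mirror level:
translation by `−c e₀` (compact supports, disjointness and the pair Gram property are translation invariant
notions), the core bound, and absorption of `(2(1+|c|))^M` into the Schwartz weights. [folklore] -/
theorem norm_three_point_standard_disjoint
    (hcone : ∀ (ψ : h.Hilbert) (μ : Measure (EuclideanSpace ℝ (Fin 4))),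
      h.IsJointSpectralMeasure ψ μ → μ {p | p 0 < |p 1|} = 0)
    (hpsd : (∀ (f₁ f₂ q : 𝓢(EuclideanSpace ℝ (Fin 4), ℂ)), HasCompactSupport (f₁ : EuclideanSpace ℝ (Fin 4) → ℂ) →
    HasCompactSupport (f₂ : EuclideanSpace ℝ (Fin 4) → ℂ) → HasCompactSupport (q : EuclideanSpace ℝ (Fin 4) → ℂ) →
    tsupport (f₁ : EuclideanSpace ℝ (Fin 4) → ℂ) ⊆ {y | y 0 < 0} →
    tsupport (f₂ : EuclideanSpace ℝ (Fin 4) → ℂ) ⊆ {y | y 0 < 0} →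
    tsupport (q : EuclideanSpace ℝ (Fin 4) → ℂ) ⊆ {y | 0 < y 0} →
    Disjoint (tsupport (f₁ : EuclideanSpace ℝ (Fin 4) → ℂ)) (tsupport (f₂ : EuclideanSpace ℝ (Fin 4) → ℂ)) →
    ∀ lam mu : ℂ,
    0 ≤ (conj lam * lam * S 4 (SchwartzMap.tensorFin 4 ![f₁, f₂, starTest (thetaTest 4 f₂), starTest (thetaTest 4 f₁)]) +
        conj lam * mu * S 3 (SchwartzMap.tensorFin 3 ![f₁, f₂, q]) +
        conj mu * lam * S 3 (SchwartzMap.tensorFin 3 ![starTest (thetaTest 4 q), starTest (thetaTest 4 f₂),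
          starTest (thetaTest 4 f₁)]) +
        conj mu * mu * S 2 (SchwartzMap.tensorFin 2 ![starTest (thetaTest 4 q), q])).re ∧
      (conj lam * lam * S 4 (SchwartzMap.tensorFin 4 ![f₁, f₂, starTest (thetaTest 4 f₂), starTest (thetaTest 4 f₁)]) +
        conj lam * mu * S 3 (SchwartzMap.tensorFin 3 ![f₁, f₂, q]) +
        conj mu * lam * S 3 (SchwartzMap.tensorFin 3 ![starTest (thetaTest 4 q), starTest (thetaTest 4 f₂),
          starTest (thetaTest 4 f₁)]) +
        conj mu * mu * S 2 (SchwartzMap.tensorFin 2 ![starTest (thetaTest 4 q), q])).im = 0))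
    {M : ℕ} (M₂ : ℕ) (C₂ : ℝ) (hS2 : ∀ F, ‖S 2 F‖ ≤ C₂ * schwartzNorm M₂ F) (hM₂ : M₂ ≤ M)
    (M₄ : ℕ) (C₄ : ℝ) (hS4 : ∀ F, ‖S 4 F‖ ≤ C₄ * schwartzNorm M₄ F) (hM₄ : M₄ ≤ M)
    (N : ℕ) {δ : ℝ} (hδ : 0 < δ) (hδ1 : δ ≤ 1) (c : ℝ) (f₁ f₂ g : 𝓢(EuclideanSpace ℝ (Fin 4), ℂ))
    (hf₁c : HasCompactSupport (f₁ : EuclideanSpace ℝ (Fin 4) → ℂ))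
    (hf₂c : HasCompactSupport (f₂ : EuclideanSpace ℝ (Fin 4) → ℂ))
    (hgc : HasCompactSupport (g : EuclideanSpace ℝ (Fin 4) → ℂ))
    (hf₁ : tsupport (f₁ : EuclideanSpace ℝ (Fin 4) → ℂ) ⊆ {y | y 0 < c})
    (hf₂ : tsupport (f₂ : EuclideanSpace ℝ (Fin 4) → ℂ) ⊆ {y | y 0 < c})
    (hg : tsupport (g : EuclideanSpace ℝ (Fin 4) → ℂ) ⊆ {y | c + δ < y 0})
    (hdis : Disjoint (tsupport (f₁ : EuclideanSpace ℝ (Fin 4) → ℂ)) (tsupport (f₂ : EuclideanSpace ℝ (Fin 4) → ℂ)))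
    {w : EuclideanSpace ℝ (Fin 4)} (hw : w = EuclideanSpace.single (0 : Fin 4) (1 : ℝ) ∨
      w = EuclideanSpace.single (1 : Fin 4) (1 : ℝ)) :
    ‖S 3 (SchwartzMap.tensorFin 3 ![f₁, f₂,
        ((∂_{w} : 𝓢(EuclideanSpace ℝ (Fin 4), ℂ) → 𝓢(EuclideanSpace ℝ (Fin 4), ℂ))^[N]) g])‖ ≤
      ((2 * N : ℕ) / (Real.exp 1 * (δ / 2))) ^ N *
        (Real.sqrt (|C₄| * (2 ^ (M₄ + 1)) ^ 4) * Real.sqrt (2 * (|C₂| * (2 ^ (M₂ + 1)) ^ 2 * 16 ^ M₂))) *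
        ((2 : ℝ) ^ (3 * M) * 2 ^ (3 * M)) *
        (schwartzNorm (M + 3 * M) f₁ * schwartzNorm (M + 3 * M) f₂ * schwartzNorm (M + 3 * M) g) := by
  set e₀ : EuclideanSpace ℝ (Fin 4) := EuclideanSpace.single (0 : Fin 4) (1 : ℝ) with he₀
  have he₀n : ‖e₀‖ = 1 := by simp [he₀]
  set a : EuclideanSpace ℝ (Fin 4) := -(c • e₀) with ha
  have han : ‖a‖ = |c| := by rw [ha, norm_neg, norm_smul, he₀n, mul_one, Real.norm_eq_abs]
  set f₁' := SchwartzMap.compSubConstCLM ℂ a f₁ with hf₁'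
  set f₂' := SchwartzMap.compSubConstCLM ℂ a f₂ with hf₂'
  set g' := SchwartzMap.compSubConstCLM ℂ a g with hg'
  have hshift : ∀ (φ : 𝓢(EuclideanSpace ℝ (Fin 4), ℂ)) (P : ℝ → Prop),
      tsupport (φ : EuclideanSpace ℝ (Fin 4) → ℂ) ⊆ {y | P (y 0)} →
      tsupport ((SchwartzMap.compSubConstCLM ℂ a φ : 𝓢(EuclideanSpace ℝ (Fin 4), ℂ)) :
        EuclideanSpace ℝ (Fin 4) → ℂ) ⊆ {y | P (y 0 + c)} := by
    intro φ P hφ y hy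
    have h1 := hφ (sub_mem_tsupport_of_mem_tsupport_compSubConstCLM a φ hy)
    simp only [mem_setOf_eq, ha, he₀, sub_neg_eq_add] at h1
    have h2 : (y + c • EuclideanSpace.single (0 : Fin 4) (1 : ℝ)) 0 = y 0 + c := by simp
    rwa [h2] at h1
  have hcpt : ∀ (φ : 𝓢(EuclideanSpace ℝ (Fin 4), ℂ)), HasCompactSupport (φ : EuclideanSpace ℝ (Fin 4) → ℂ) →
      HasCompactSupport ((SchwartzMap.compSubConstCLM ℂ a φ : 𝓢(EuclideanSpace ℝ (Fin 4), ℂ)) :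
        EuclideanSpace ℝ (Fin 4) → ℂ) := by
    intro φ hφ
    have hfun : ((SchwartzMap.compSubConstCLM ℂ a φ : 𝓢(EuclideanSpace ℝ (Fin 4), ℂ)) : EuclideanSpace ℝ (Fin 4) → ℂ) =
        (φ : EuclideanSpace ℝ (Fin 4) → ℂ) ∘ (Homeomorph.addRight (-a)) := by
      funext y
      simp [SchwartzMap.compSubConstCLM_apply, sub_eq_add_neg]
    rw [hfun]
    exact hφ.comp_homeomorph _
  have hf₁'s : tsupport (f₁' : EuclideanSpace ℝ (Fin 4) → ℂ) ⊆ {y | y 0 < 0} := fun y hy => by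
    have := hshift f₁ (· < c) hf₁ hy; simp only [mem_setOf_eq] at this ⊢; linarith
  have hf₂'s : tsupport (f₂' : EuclideanSpace ℝ (Fin 4) → ℂ) ⊆ {y | y 0 < 0} := fun y hy => by
    have := hshift f₂ (· < c) hf₂ hy; simp only [mem_setOf_eq] at this ⊢; linarith
  have hg's : tsupport (g' : EuclideanSpace ℝ (Fin 4) → ℂ) ⊆ {y | δ < y 0} := fun y hy => by
    have := hshift g (fun t => c + δ < t) hg hy; simp only [mem_setOf_eq] at this ⊢; linarith
  have hdis' : Disjoint (tsupport (f₁' : EuclideanSpace ℝ (Fin 4) → ℂ)) (tsupport (f₂' : EuclideanSpace ℝ (Fin 4) → ℂ)) :=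
    Set.disjoint_left.2 fun y hy1 hy2 =>
      Set.disjoint_left.1 hdis (sub_mem_tsupport_of_mem_tsupport_compSubConstCLM a f₁ hy1)
        (sub_mem_tsupport_of_mem_tsupport_compSubConstCLM a f₂ hy2)
  -- the translated tensor has the same value
  set q : 𝓢(EuclideanSpace ℝ (Fin 4), ℂ) :=
    ((∂_{w} : 𝓢(EuclideanSpace ℝ (Fin 4), ℂ) → 𝓢(EuclideanSpace ℝ (Fin 4), ℂ))^[N]) g with hq
  set q' : 𝓢(EuclideanSpace ℝ (Fin 4), ℂ) :=
    ((∂_{w} : 𝓢(EuclideanSpace ℝ (Fin 4), ℂ) → 𝓢(EuclideanSpace ℝ (Fin 4), ℂ))^[N]) g' with hq'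
  have hqq : q' = SchwartzMap.compSubConstCLM ℂ a q := by
    rw [hq', hg', iterate_lineDerivOp_compSubConstCLM]
  have hqs : tsupport (q : EuclideanSpace ℝ (Fin 4) → ℂ) ⊆ {y | c + δ < y 0} :=
    (tsupport_iterate_lineDerivOp_subset w N g).trans hg
  have hdis1q : Disjoint (tsupport (f₁ : EuclideanSpace ℝ (Fin 4) → ℂ)) (tsupport (q : EuclideanSpace ℝ (Fin 4) → ℂ)) :=
    Set.disjoint_left.2 fun y hy1 hy2 => by
      have := hf₁ hy1; have := hqs hy2; simp only [mem_setOf_eq] at *; linarith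
  have hdis2q : Disjoint (tsupport (f₂ : EuclideanSpace ℝ (Fin 4) → ℂ)) (tsupport (q : EuclideanSpace ℝ (Fin 4) → ℂ)) :=
    Set.disjoint_left.2 fun y hy1 hy2 => by
      have := hf₂ hy1; have := hqs hy2; simp only [mem_setOf_eq] at *; linarith
  have hoff : IsOffDiagonal (SchwartzMap.tensorFin 3 ![f₁, f₂, q]) := isOffDiagonal_tensorFin_three hdis hdis1q hdis2q
  have hT : ∀ (v : EuclideanSpace ℝ (Fin 4)) (F : 𝓢((Fin 3 → EuclideanSpace ℝ (Fin 4)), ℂ)),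
      IsOffDiagonal F → S 3 (translateMulti v F) = S 3 F := fun v F hF => by
    have := h.translationInvariant 3 (fun _ => ()) v F hF
    simpa only [SchwingerFamily.toLabelled_apply] using this
  have hval : S 3 (SchwartzMap.tensorFin 3 ![f₁, f₂, q]) = S 3 (SchwartzMap.tensorFin 3 ![f₁', f₂', q']) := by
    rw [hqq, hf₁', hf₂', ← translateMulti_tensorFin_three, hT a _ hoff]
  set K : ℝ := ((2 * N : ℕ) / (Real.exp 1 * (δ / 2))) ^ N *
    (Real.sqrt (|C₄| * (2 ^ (M₄ + 1)) ^ 4) * Real.sqrt (2 * (|C₂| * (2 ^ (M₂ + 1)) ^ 2 * 16 ^ M₂))) with hK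
  have hK0 : 0 ≤ K := by positivity
  have hcore : ‖S 3 (SchwartzMap.tensorFin 3 ![f₁', f₂', q'])‖ ≤
      K * schwartzNorm M₄ f₁' * schwartzNorm M₄ f₂' * schwartzNorm M₂ g' :=
    norm_three_point_core_disjoint S h hcone hpsd M₂ C₂ hS2 M₄ C₄ hS4 N hδ hδ1 f₁' f₂' g' (hcpt f₁ hf₁c)
      (hcpt f₂ hf₂c) (hcpt g hgc) hf₁'s hf₂'s hg's hdis' hw
  -- translated Schwartz norms (verbatim as for ordered pairs)
  have htr : ∀ (φ : 𝓢(EuclideanSpace ℝ (Fin 4), ℂ)) {M' : ℕ}, M' ≤ M →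
      schwartzNorm M' (SchwartzMap.compSubConstCLM ℂ a φ) ≤ 2 ^ M * (1 + |c|) ^ M * schwartzNorm M φ := by
    intro φ M' hM'
    refine (NuclearExpansion.schwartzNorm_compSubConstCLM_le M' a φ).trans ?_
    rw [han, ← mul_pow]
    have h1 : (1 : ℝ) ≤ 2 * (1 + |c|) := by linarith [abs_nonneg c]
    exact mul_le_mul (pow_le_pow_right₀ h1 hM') (schwartzNorm_mono hM' φ) (schwartzNorm_nonneg _ _)
      (by positivity)
  have hn1 := htr f₁ hM₄
  have hn2 := htr f₂ hM₄
  have hn3 := htr g hM₂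
  have h0f₁ := schwartzNorm_nonneg M f₁
  have h0f₂ := schwartzNorm_nonneg M f₂
  have h0g := schwartzNorm_nonneg M g
  have hU0 : 0 ≤ (2 : ℝ) ^ M * (1 + |c|) ^ M := by positivity
  have h2p : (2 : ℝ) ^ M * 2 ^ M * 2 ^ M = 2 ^ (3 * M) := by
    rw [← pow_add, ← pow_add]; congr 1; ring
  have hup : (1 + |c|) ^ M * (1 + |c|) ^ M * (1 + |c|) ^ M = (1 + |c|) ^ (3 * M) := by
    rw [← pow_add, ← pow_add]; congr 1; ring
  have hstep : ‖S 3 (SchwartzMap.tensorFin 3 ![f₁, f₂, q])‖ ≤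
      K * (2 : ℝ) ^ (3 * M) * ((1 + |c|) ^ (3 * M) * (schwartzNorm M f₁ * schwartzNorm M f₂ * schwartzNorm M g)) := by
    rw [hval]
    refine hcore.trans ?_
    have h02 := schwartzNorm_nonneg M₄ f₂'
    have h03 := schwartzNorm_nonneg M₂ g'
    have hs1 : K * schwartzNorm M₄ f₁' ≤ K * (2 ^ M * (1 + |c|) ^ M * schwartzNorm M f₁) :=
      mul_le_mul_of_nonneg_left hn1 hK0
    have hs2 : K * schwartzNorm M₄ f₁' * schwartzNorm M₄ f₂' ≤
        K * (2 ^ M * (1 + |c|) ^ M * schwartzNorm M f₁) * (2 ^ M * (1 + |c|) ^ M * schwartzNorm M f₂) :=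
      mul_le_mul hs1 hn2 h02 (mul_nonneg hK0 (mul_nonneg hU0 h0f₁))
    have hs3 : K * schwartzNorm M₄ f₁' * schwartzNorm M₄ f₂' * schwartzNorm M₂ g' ≤
        K * (2 ^ M * (1 + |c|) ^ M * schwartzNorm M f₁) * (2 ^ M * (1 + |c|) ^ M * schwartzNorm M f₂) *
          (2 ^ M * (1 + |c|) ^ M * schwartzNorm M g) :=
      mul_le_mul hs2 hn3 h03 (mul_nonneg (mul_nonneg hK0 (mul_nonneg hU0 h0f₁)) (mul_nonneg hU0 h0f₂))
    refine hs3.trans (le_of_eq ?_)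
    rw [← h2p, ← hup]
    ring
  have habs : (1 + |c|) ^ (3 * M) * (schwartzNorm M f₁ * schwartzNorm M f₂ * schwartzNorm M g) ≤
      2 ^ (3 * M) * (schwartzNorm (M + 3 * M) f₁ * schwartzNorm (M + 3 * M) f₂ * schwartzNorm (M + 3 * M) g) := by
    have hm1 := schwartzNorm_mono (Nat.le_add_right M (3 * M)) f₁
    have hm2 := schwartzNorm_mono (Nat.le_add_right M (3 * M)) f₂
    have hm3 := schwartzNorm_mono (Nat.le_add_right M (3 * M)) g
    rcases le_or_gt 0 c with hc | hc
    · have hgfar : tsupport (g : EuclideanSpace ℝ (Fin 4) → ℂ) ⊆ {y | |c| ≤ ‖y‖} := fun y hy => by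
        have h1 := hg hy
        simp only [mem_setOf_eq] at h1 ⊢
        have h2 : |y 0| ≤ ‖y‖ := by
          rw [← Real.norm_eq_abs]; exact PiLp.norm_apply_le y 0
        rw [abs_of_nonneg hc]
        have h3 : y 0 ≤ |y 0| := le_abs_self _
        linarith
      have hA := one_add_pow_mul_schwartzNorm_le g (abs_nonneg c) hgfar M (3 * M)
      have hB : schwartzNorm M f₁ * schwartzNorm M f₂ ≤ schwartzNorm (M + 3 * M) f₁ * schwartzNorm (M + 3 * M) f₂ :=
        mul_le_mul hm1 hm2 h0f₂ (h0f₁.trans hm1)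
      calc (1 + |c|) ^ (3 * M) * (schwartzNorm M f₁ * schwartzNorm M f₂ * schwartzNorm M g)
          = schwartzNorm M f₁ * schwartzNorm M f₂ * ((1 + |c|) ^ (3 * M) * schwartzNorm M g) := by ring
        _ ≤ schwartzNorm (M + 3 * M) f₁ * schwartzNorm (M + 3 * M) f₂ * (2 ^ (3 * M) * schwartzNorm (M + 3 * M) g) :=
            mul_le_mul hB hA (by positivity) (mul_nonneg (h0f₁.trans hm1) (h0f₂.trans hm2))
        _ = _ := by ring
    · have hffar : tsupport (f₁ : EuclideanSpace ℝ (Fin 4) → ℂ) ⊆ {y | |c| ≤ ‖y‖} := fun y hy => by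
        have h1 := hf₁ hy
        simp only [mem_setOf_eq] at h1 ⊢
        have h2 : |y 0| ≤ ‖y‖ := by
          rw [← Real.norm_eq_abs]; exact PiLp.norm_apply_le y 0
        rw [abs_of_neg hc]
        have h3 : -(y 0) ≤ |y 0| := neg_le_abs _
        linarith
      have hA := one_add_pow_mul_schwartzNorm_le f₁ (abs_nonneg c) hffar M (3 * M)
      have hA0 : 0 ≤ 2 ^ (3 * M) * schwartzNorm (M + 3 * M) f₁ := by
        have := schwartzNorm_nonneg (M + 3 * M) f₁; positivity
      calc (1 + |c|) ^ (3 * M) * (schwartzNorm M f₁ * schwartzNorm M f₂ * schwartzNorm M g)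
          = ((1 + |c|) ^ (3 * M) * schwartzNorm M f₁) * schwartzNorm M f₂ * schwartzNorm M g := by ring
        _ ≤ (2 ^ (3 * M) * schwartzNorm (M + 3 * M) f₁) * schwartzNorm (M + 3 * M) f₂ * schwartzNorm (M + 3 * M) g :=
            mul_le_mul (mul_le_mul hA hm2 h0f₂ hA0) hm3 h0g (mul_nonneg hA0 (h0f₂.trans hm2))
        _ = _ := by ring
  calc ‖S 3 (SchwartzMap.tensorFin 3 ![f₁, f₂, q])‖
      ≤ K * (2 : ℝ) ^ (3 * M) * ((1 + |c|) ^ (3 * M) * (schwartzNorm M f₁ * schwartzNorm M f₂ * schwartzNorm M g)) := hstep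
    _ ≤ K * (2 : ℝ) ^ (3 * M) * (2 ^ (3 * M) * (schwartzNorm (M + 3 * M) f₁ * schwartzNorm (M + 3 * M) f₂ *
          schwartzNorm (M + 3 * M) g)) := mul_le_mul_of_nonneg_left habs (by positivity)
    _ = _ := by ring

end PartTwoCore

end Summit.QuantumFields.YangMills.Theorems.TemperedCurvatureMoments.Sketch.ThreePointChartBounds

end
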